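import Summits.QuantumFields.YangMills.Theorems.BalabanUVNodesPortS1CfgGerm
import Summits.QuantumFields.YangMills.Theorems.BalabanUVNodesK0RecordFormatNamesIntLocalW

/-!
# NODE O port PT-A — THE ADAPTER «configuration-level localized representation ⟹ wrap-aware residue»: torus-level pieces `E n X` at EVERY domain with rows (a)(b)(c)(d), whose
# OFF-WRAP members are the pull-back pieces of ONE integer formula `Ψ`, and a configuration-level identity `G(U) = Σ_X E_X((U, J(U)) cut to X)` on a small-field ball, give
# `Ψ.ResidueAtW F Mc k E … (fun n B => G n (U_{k+1}(W_B)))` — the shape in which [16] (63) ∕ [II] (2.13) deliver their halves (print never mentions `B`)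

Cell `ym-nodeO-ideate`, porter seat `ymgap-nodeO-port-PTA-1` (gen 3); `--supports stmt-QuantumFields-27930` (helper).  [I] = [Balaban1987RG1], [II] = [Balaban1988RG2Cluster],
[16] = [Balaban1985UVStability3D].  Over DEF-1 ed.13c (`TorusPieces`, `ResidueAtW`, `pairCutTorusAt`) and gen 3's `…PortS1CfgGerm` (`eventually_norm_recordBgField_sub_one_lt_at`).
* §1 `pairCutTorusAt_eq` (`rfl`: the torus-level cut pair read at the rooted field and its `sl2Proj`-current), `pairCutAt_eq_pullPair_pairCutTorusAt` (`rfl`).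
* §2 ★★★ `residueAtW_of_cfgPieces`.

HONEST FRAMING.  Plumbing; NO expansion of Bałaban's constructed or asserted; the residue is NOT proved; 27930 OPEN; K0⁷ NOT closed; NODE O 0∕1; COUNT 8∕28 · K 1∕4 UNMOVED; finite `𝕋⁴_{L^K}` at
fixed ε — NOT continuum ∕ OS ∕ Clay; **the Yang–Mills mass gap is NOT proved by any of this.**  No `sorry`, no `def`, no `instance`; standard axioms.
-/

noncomputable section

open scoped BigOperators Matrix.Norms.L2Operator Topology

namespace Summit.QuantumFields.YangMills.Theorems.BalabanUVNodesPortS1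

open Summit.QuantumFields.YangMills.Theorems.K0RecordFormatNames
open Literature.MathematicalPhysics.QuantumFieldTheory.Balaban1983to89
open Literature.MathematicalPhysics.QuantumFieldTheory.Balaban1983to89.Node00
open Literature.MathematicalPhysics.QuantumFieldTheory.Balaban1983to89.T4Continuum (T4Family)
open _root_.Filter

variable (F : T4Family)

/-! ## §1  The torus-level cut pair, unfolded -/

open scoped Classical in
/-- The torus-level cut pair of ed.13c read at the rooted field with its (1.8) current written through `ιSU ∘ recordBgField` (`rfl`). [cite: Balaban1987RG1, (1.8)–(1.9) p.261 (bookkeeping)] -/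
theorem pairCutTorusAt_eq (a₀ ε₂₉ : ℝ) (Mc k K : ℕ) (X : (recordDomSys F Mc k K).Dom) (B : recordW F a₀ ε₂₉ k K) :
    letI θ := thetaFill F a₀ ε₂₉; letI := θ.instVβ₁; letI := θ.instVβ₂; letI := θ.instιβ
    pairCutTorusAt F a₀ ε₂₉ Mc k K X B =
      (fun b => if b ∈ domBonds F Mc k K X then ((recordBgField F θ k K B b : SU 2) : MatA 2) else 1,
       fun b => if b ∈ domBonds F Mc k K X then
         B12Eq18Current.current sl2Proj ((F.P K).eta (k + 1)) (fun b => ιSU 2 (recordBgField F θ k K B b)) b else 0) :=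
  rfl

/-- `pairCutAt` (ed.13) IS the pull-back of `pairCutTorusAt` (ed.13c) (`rfl`). [cite: Balaban1987RG1, (1.9) p.261 (bookkeeping)] -/
theorem pairCutAt_eq_pullPair_pairCutTorusAt (a₀ ε₂₉ : ℝ) (Mc k K : ℕ) (X : (recordDomSys F Mc k K).Dom) (B : recordW F a₀ ε₂₉ k K) :
    pairCutAt F a₀ ε₂₉ Mc k K X B = pullPair F K (pairCutTorusAt F a₀ ε₂₉ Mc k K X B) := rfl

/-! ## §2  ★★★ Configuration-level pieces ⟹ the wrap-aware residue -/

open scoped Classical in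
/-- ★★★ **CONFIGURATION-LEVEL LOCALIZED REPRESENTATION ⟹ WRAP-AWARE RESIDUE.**  Data at every volume `K₀ + n`: torus-level pieces `E n X : Sect2.CPair → ℂ` for EVERY domain `X` with (a)
analyticity and (b) the (1.18) bound on the record spaces, (c) (1.7) locality on the sites of `X`, (d) (1.19) invariance under `recordGaugeGrp`; the OFF-WRAP pieces are the pull-back
pieces of ONE object `Ψ` (`E n X = Ψ.Ψ.piece … X` for `X ∉ recordWrapCtr`); and functionals `G n` of the fine field with the identity `G n U = Σ_X E n X ((U, J_ξ(U)) cut to X)` for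
every `U` with `‖U_b − 1‖ < δ_n` on all bonds.  Then, under the TokP9-reg shape, `Ψ.ResidueAtW F Mc k E a₀ ε₂₉ α₀ α₁ E₀ κ (fun n B => G n (U_{k+1}(W_B)))`.
[cite: Balaban1987RG1, (1.6)–(1.9) p.261, (1.18)–(1.19) p.263, (1.21) p.264; Balaban1985UVStability3D, (63) p.272; Balaban1988RG2Cluster, (2.13) p.14; Balaban1985Variational, Prop. 9 p.309] -/
theorem residueAtW_of_cfgPieces (Mc k : ℕ) (a₀ ε₂₉ α₀ α₁ E₀ κ : ℝ) (Ψ : IntLocalFormula (F.L ^ (k + 1) * Mc)) (E : TorusPieces F Mc k)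
    (G : (n : ℕ) → GaugeField (F.P (recordK₀ F Mc k + n)) 0 (SU 2) → ℂ)
    (hP9 : ∀ n, letI θ := thetaFill F a₀ ε₂₉; letI := θ.instVβ₁; letI := θ.instVβ₂; letI := θ.instιβ
      AnalyticAt ℝ (fun B : recordW F a₀ ε₂₉ k (recordK₀ F Mc k + n) => fun (b : PBond (F.P (recordK₀ F Mc k + n)) 0) (i i' : Fin 2) =>
        ((recordBgField F θ k (recordK₀ F Mc k + n) B b : SU 2) : Matrix (Fin 2) (Fin 2) ℂ) i i') 0)
    (hEΨ : ∀ n (X : (recordDomSys F Mc k (recordK₀ F Mc k + n)).Dom), X ∉ recordWrapCtr F Mc k (recordK₀ F Mc k + n) →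
      ∀ φ, E n X φ = Ψ.Ψ.piece F Mc k (recordK₀ F Mc k + n) X φ)
    (hEA : ∀ n (X : (recordDomSys F Mc k (recordK₀ F Mc k + n)).Dom) (φ : Sect2.CPair (F.P (recordK₀ F Mc k + n)) (MatA 2)),
      encodeCfg F (recordK₀ F Mc k + n) φ ∈ recordUc F Mc k α₀ α₁ (recordK₀ F Mc k + n) X → AnalyticAt ℂ (E n X) φ)
    (hEB : ∀ n (X : (recordDomSys F Mc k (recordK₀ F Mc k + n)).Dom) (φ : Sect2.CPair (F.P (recordK₀ F Mc k + n)) (MatA 2)),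
      encodeCfg F (recordK₀ F Mc k + n) φ ∈ recordUc F Mc k α₀ α₁ (recordK₀ F Mc k + n) X →
        ‖E n X φ‖ ≤ E₀ * Real.exp (-κ * (recordDomSys F Mc k (recordK₀ F Mc k + n)).dj X))
    (hEL : ∀ n (X : (recordDomSys F Mc k (recordK₀ F Mc k + n)).Dom) (φ ψ : Sect2.CPair (F.P (recordK₀ F Mc k + n)) (MatA 2)),
      Sect2.agreeOnSet (Sect2.domSites (F.P (recordK₀ F Mc k + n)) Mc (k + 1) X) φ ψ → E n X φ = E n X ψ)
    (hEG : ∀ n (X : (recordDomSys F Mc k (recordK₀ F Mc k + n)).Dom) (u : recordGaugeGrp F (recordK₀ F Mc k + n)) φ, E n X (Sect2.cAct u.1 φ) = E n X φ)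
    (hcfg : ∀ n, ∃ δ : ℝ, 0 < δ ∧ ∀ U : GaugeField (F.P (recordK₀ F Mc k + n)) 0 (SU 2),
      (∀ b, ‖((U b : SU 2) : MatA 2) - 1‖ < δ) →
        G n U = ∑ X : (recordDomSys F Mc k (recordK₀ F Mc k + n)).Dom,
          E n X (fun b => if b ∈ domBonds F Mc k (recordK₀ F Mc k + n) X then ((U b : SU 2) : MatA 2) else 1,
                 fun b => if b ∈ domBonds F Mc k (recordK₀ F Mc k + n) X then
                   B12Eq18Current.current sl2Proj ((F.P (recordK₀ F Mc k + n)).eta (k + 1)) (fun b => ιSU 2 (U b)) b else 0)) :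
    Ψ.ResidueAtW F Mc k E a₀ ε₂₉ α₀ α₁ E₀ κ
      (fun n B => letI θ := thetaFill F a₀ ε₂₉; letI := θ.instVβ₁; letI := θ.instVβ₂; letI := θ.instιβ
        G n (recordBgField F θ k (recordK₀ F Mc k + n) B)) := by
  refine ⟨fun n X hX φ hφ => ?_, fun n X hX φ hφ => ?_, fun n X _ φ hφ => hEA n X φ hφ, fun n X _ φ hφ => hEB n X φ hφ,
    fun n X _ φ ψ hag => hEL n X φ ψ hag, fun n X _ u φ => hEG n X u φ, fun n => ?_⟩
  · -- (a) off-wrap: the pull-back piece IS the cfg-level piece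
    have hfun : (fun ψ => Ψ.Ψ.piece F Mc k (recordK₀ F Mc k + n) X ψ) = E n X := funext fun ψ => (hEΨ n X hX ψ).symm
    rw [hfun]
    exact hEA n X φ hφ
  · -- (b) off-wrap
    rw [← hEΨ n X hX φ]
    exact hEB n X φ hφ
  · -- (f′)-W from the configuration-level identity and the eventual smallness of the rooted field
    letI θ := thetaFill F a₀ ε₂₉; letI := θ.instVβ₁; letI := θ.instVβ₂; letI := θ.instιβ
    obtain ⟨δ, hδ, hid⟩ := hcfg n
    filter_upwards [eventually_norm_recordBgField_sub_one_lt_at F a₀ ε₂₉ Mc k n (hP9 n) hδ] with B hB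
    rw [hid _ hB]
    refine Finset.sum_congr rfl fun X _ => ?_
    by_cases hX : X ∈ recordWrapCtr F Mc k (recordK₀ F Mc k + n)
    · rw [if_pos hX]
      rfl
    · rw [if_neg hX, pairCutAt_eq_pullPair_pairCutTorusAt]
      exact hEΨ n X hX _

end Summit.QuantumFields.YangMills.Theorems.BalabanUVNodesPortS1

end
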